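import Mathlib
import Literature.NumberTheory.Sieve.BombieriVinogradovReduction
import Literature.NumberTheory.LFunctions.PagePNTWithExceptionalZeroProofs
import Summits.Parity.GeneralizedHardyLittlewood.Theorems.LiouvilleShiftedTablesEHStubDescent

/-!
# The graded descent (stub `stub_descentGraded` of line `upward-replication-free-factorability`, crux `EH`)

The level-by-level form of the descent `…Theorems.EH.Descent.stub_descent`: the inputs `H1`
(low conductors are harmless), `H2` (replication `E♯_D(x; q) ≤ (p − 1) E♯_D(x; qp) + R(qp, x)`
for a prime `p ∤ q`) and `H4` (bad moduli are harmonically sparse) of the line, taken VERBATIM as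
hypotheses, together with purity of the SINGLE window of moduli `m ∈ (x^{1−ε'}, 2x^{1−ε'}]` off
an exceptional set `I` with `#I ≤ x^{1−ε'−η}` (hypothesis `H3` of `stub_descent` at one fixed
`ε' > 0`, no upper bound on `ε'` needed), already give `Literature.NumberTheory.Sieve.EH θ` for
every level `θ < 1 − ε'`.  So purity just beyond `x^{1/2}` gives a level of distribution just
beyond `1/2`.

Proof.  Identical to the final assembly of `stub_descent`, with `ε'` given instead of chosen:
fix `θ < 1 − ε'` (so `θ < 1` and `κ = 1 − ε' − θ > 0`); it suffices to treat `A > 0`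
(`eh_of_pos`).  With `B = A + 2`, purity gives `δ₀, η, x₀` and, for `x ≥ x₀`, the set `I`; `H4`
(at `κ > 0`) gives `K, x₁`; `H1` (at `θ < 1`) gives `C₀`.  At height `x`: `|Δ| ≤ E♭ + E♯`
(`ciSup_abs_le_ciSup_add`); good/bad split of the moduli `q ≤ x^θ` (`sum_le_of_good_bad`):
replication + purity on the good moduli (`le_of_replication_of_pure`,
`nonCoprimePart_le_three_mul_log_sq`, using `qp ≤ 2x^{1−ε'} ≤ 2x`), the trivial bound
(`ciSup_abs_sub_le_trivial`) + harmonic sparsity on the bad ones; finally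
`∑_{q ≤ Q} 1/φ(q) ≤ 4 (log x)²` and the eventual comparisons of `x^θ L²`, `x^{1−η} L³` with
`x/L^A` (`numeric_bound`, `eventually_rpow_mul_log_pow_le`).

References: H. Davenport, *Multiplicative Number Theory*, 2nd ed., Springer GTM 74 (1980),
ch. 28 (the Bombieri–Vinogradov bookkeeping); H. L. Montgomery, R. C. Vaughan,
*Multiplicative Number Theory I*, CUP 2007, proof of Corollary 11.17 (the trivial bound).
-/

open Finset Real Filter Asymptotics

namespace Summit.Parity.GeneralizedHardyLittlewood.Theorems.EH.DescentGraded

open Literature.NumberTheory.Sieve Literature.NumberTheory.LFunctions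
open Summit.Parity.GeneralizedHardyLittlewood.Theorems.EH.Descent

/-- `EH θ` (all real `A`) follows from the bound for `A > 0`:
`x/(log x)^{max(A,1)} ≤ x/(log x)^A` once `log x ≥ 1`. [folklore] -/
theorem eh_of_pos (θ : ℝ)
    (h : ∀ A : ℝ, 0 < A →
      (fun x : ℝ => ∑ q ∈ Icc 1 ⌊x ^ θ⌋₊,
        ⨆ a : (ZMod q)ˣ, |ParityWave0.chebyshevPsiMod q a x - x / Nat.totient q|) =O[atTop]
      fun x : ℝ => x / Real.log x ^ A) :
    Literature.NumberTheory.Sieve.EH θ := by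
  intro A
  refine (h (max A 1) (lt_max_of_lt_right one_pos)).trans (IsBigO.of_bound 1 ?_)
  filter_upwards [Real.tendsto_log_atTop.eventually_ge_atTop (1 : ℝ),
    eventually_ge_atTop (0 : ℝ)] with x hL hx
  have hL0 : 0 < Real.log x := by linarith
  rw [one_mul, Real.norm_of_nonneg (div_nonneg hx (Real.rpow_nonneg hL0.le _)),
    Real.norm_of_nonneg (div_nonneg hx (Real.rpow_nonneg hL0.le _))]
  exact div_le_div_of_nonneg_left hx (Real.rpow_pos_of_pos hL0 _)
    (Real.rpow_le_rpow_of_exponent_le hL (le_max_left _ _))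

/-- **Graded descent** (the level-by-level form of stub 5 of the line): `H1` (low conductors are
harmless), `H2` (replication) and `H4` (bad moduli are harmonically sparse), taken verbatim as
hypotheses, together with purity of the single window of moduli `m ∈ (x^{1−ε'}, 2x^{1−ε'}]` off
an exceptional set of size `≤ x^{1−ε'−η}` at one fixed `ε' > 0`, give
`Literature.NumberTheory.Sieve.EH θ` for every `θ < 1 − ε'`: triangle inequality
`|Δ| ≤ E♭ + E♯`, good/bad split of the moduli `q ≤ x^θ`, replication + purity on the good moduli,
the trivial bound + harmonic sparsity on the bad ones, and the eventual comparisons of `x^θ L²`,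
`x^{1−η} L³` with `x/L^A`. [cite: DavenportMNT1980, ch. 28] -/
theorem stub_descentGraded :
    (∀ δ₀ : ℝ, 0 < δ₀ → δ₀ < 1 / 2 → ∀ θ : ℝ, θ < 1 → ∀ A : ℝ, 0 < A →
      (fun x : ℝ => ∑ q ∈ Finset.Icc 1 ⌊x ^ θ⌋₊, ⨆ a : (ZMod q)ˣ,
          ‖((Literature.NumberTheory.Sieve.ParityWave0.chebyshevPsiMod q (a : ZMod q) x -
                  x / (Nat.totient q : ℝ) : ℝ) : ℂ) -
              ((Nat.totient q : ℂ))⁻¹ *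
                ∑ χ ∈ (Finset.univ : Finset (DirichletCharacter ℂ q)) with
                    ⌊x ^ (1 / 2 - δ₀)⌋₊ < χ.conductor,
                  χ (a : ZMod q)⁻¹ * Literature.NumberTheory.Sieve.chebyshevPsiChar χ x‖) =O[Filter.atTop]
        fun x : ℝ => x / Real.log x ^ A) →
    (∀ (D : ℕ) (x : ℝ), 1 ≤ x → ∀ q : ℕ, 1 ≤ q → ∀ p : ℕ, p.Prime → ¬ p ∣ q →
      (⨆ a : (ZMod q)ˣ,
          ‖((Nat.totient q : ℂ))⁻¹ *
              ∑ χ ∈ (Finset.univ : Finset (DirichletCharacter ℂ q)) with D < χ.conductor,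
                χ (a : ZMod q)⁻¹ * Literature.NumberTheory.Sieve.chebyshevPsiChar χ x‖) ≤
        ((p : ℝ) - 1) *
            (⨆ a : (ZMod (q * p))ˣ,
              ‖((Nat.totient (q * p) : ℂ))⁻¹ *
                  ∑ χ ∈ (Finset.univ : Finset (DirichletCharacter ℂ (q * p))) with D < χ.conductor,
                    χ (a : ZMod (q * p))⁻¹ * Literature.NumberTheory.Sieve.chebyshevPsiChar χ x‖) +
          Literature.NumberTheory.Sieve.nonCoprimePart (q * p) x) →
    (∀ ε' η θ : ℝ, 0 < ε' → 0 < η → 0 < 1 - ε' - θ →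
      ∃ K x₁ : ℝ, ∀ x : ℝ, x₁ ≤ x → ∀ I : Finset ℕ, (I.card : ℝ) ≤ x ^ (1 - ε' - η) →
        ∀ Bad : Finset ℕ, Bad ⊆ Finset.Icc 1 ⌊x ^ θ⌋₊ →
          (∀ q ∈ Bad, ∀ p : ℕ, p.Prime → ¬ p ∣ q →
              x ^ (1 - ε') / q < p → (p : ℝ) ≤ 2 * x ^ (1 - ε') / q → q * p ∈ I) →
            ∑ q ∈ Bad, ((Nat.totient q : ℝ))⁻¹ ≤ K * x ^ (-η) * Real.log x ^ 2) →
    ∀ ε' : ℝ, 0 < ε' →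
      (∀ B : ℝ, 0 < B →
      ∃ δ₀ : ℝ, 0 < δ₀ ∧ δ₀ < 1 / 2 ∧ ∃ η : ℝ, 0 < η ∧ ∃ x₀ : ℝ, ∀ x : ℝ, x₀ ≤ x →
        ∃ I : Finset ℕ, (I.card : ℝ) ≤ x ^ (1 - ε' - η) ∧
          ∀ m ∈ Finset.Ioc ⌊x ^ (1 - ε')⌋₊ ⌊2 * x ^ (1 - ε')⌋₊, m ∉ I →
            (⨆ a : (ZMod m)ˣ,
                ‖((Nat.totient m : ℂ))⁻¹ *
                    ∑ χ ∈ (Finset.univ : Finset (DirichletCharacter ℂ m)) with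
                        ⌊x ^ (1 / 2 - δ₀)⌋₊ < χ.conductor,
                      χ (a : ZMod m)⁻¹ * Literature.NumberTheory.Sieve.chebyshevPsiChar χ x‖) <
              x / ((Nat.totient m : ℝ) * Real.log x ^ B)) →
      ∀ θ : ℝ, θ < 1 - ε' → Literature.NumberTheory.Sieve.EH θ := by
  intro h1 h2 h4 ε' hε h3 θ hθε
  have hθ : θ < 1 := by linarith
  have hκ : 0 < 1 - ε' - θ := by linarith
  refine eh_of_pos θ fun A hA => ?_
  obtain ⟨δ₀, hδ₀, hδ₀', η, hη, x₀, hpur⟩ := h3 (A + 2) (by linarith)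
  obtain ⟨K, x₁, hbad⟩ := h4 ε' η θ hε hη hκ
  obtain ⟨C₀, hC₀⟩ := (h1 δ₀ hδ₀ hδ₀' θ hθ A hA).bound
  refine IsBigO.of_bound (C₀ + 8 + 2 * max K 0) ?_
  filter_upwards [hC₀, eventually_ge_atTop x₀, eventually_ge_atTop x₁,
    eventually_ge_atTop (2 : ℝ), Real.tendsto_log_atTop.eventually_ge_atTop (1 : ℝ),
    eventually_rpow_mul_log_pow_le 2 A (sub_pos.2 hθ),
    eventually_rpow_mul_log_pow_le 3 A hη] with x hC₀x hx₀ hx₁ hx2 hL1 hev1 hev2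
  have hx1 : (1 : ℝ) ≤ x := by linarith
  have hx0 : (0 : ℝ) ≤ x := by linarith
  have hL0 : 0 ≤ Real.log x := by linarith
  have hw : x ^ (1 - ε') ≤ x := by
    calc x ^ (1 - ε') ≤ x ^ (1 : ℝ) := Real.rpow_le_rpow_of_exponent_le hx1 (by linarith)
      _ = x := Real.rpow_one x
  have hxθ : x ^ θ ≤ x := by
    calc x ^ θ ≤ x ^ (1 : ℝ) := Real.rpow_le_rpow_of_exponent_le hx1 hθ.le
      _ = x := Real.rpow_one x
  obtain ⟨I, hI, hpurx⟩ := hpur x hx₀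
  have main := sum_le_of_good_bad (Q := ⌊x ^ θ⌋₊) (I := I) (w := x ^ (1 - ε'))
    (M := Real.log x ^ (A + 2)) (K' := K * x ^ (-η) * Real.log x ^ 2)
    (r := 3 * Real.log x ^ 2) (L := Real.log x) (x := x)
    (T := fun q => ⨆ a : (ZMod q)ˣ, |ParityWave0.chebyshevPsiMod q a x - x / Nat.totient q|)
    (Eb := fun q => ⨆ a : (ZMod q)ˣ,
      ‖((ParityWave0.chebyshevPsiMod q (a : ZMod q) x - x / (Nat.totient q : ℝ) : ℝ) : ℂ) -
        ((Nat.totient q : ℂ))⁻¹ *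
          ∑ χ ∈ (Finset.univ : Finset (DirichletCharacter ℂ q)) with
            ⌊x ^ (1 / 2 - δ₀)⌋₊ < χ.conductor, χ (a : ZMod q)⁻¹ * chebyshevPsiChar χ x‖)
    (Es := fun m => ⨆ a : (ZMod m)ˣ,
      ‖((Nat.totient m : ℂ))⁻¹ *
        ∑ χ ∈ (Finset.univ : Finset (DirichletCharacter ℂ m)) with
          ⌊x ^ (1 / 2 - δ₀)⌋₊ < χ.conductor, χ (a : ZMod m)⁻¹ * chebyshevPsiChar χ x‖)
    (R := fun m => nonCoprimePart m x)
    hx0 hL0 (Real.rpow_pos_of_pos (by linarith) _) (by positivity)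
    (fun q hq => by
      haveI : NeZero q := ⟨by have := (Finset.mem_Icc.1 hq).1; omega⟩
      exact ciSup_abs_le_ciSup_add _ _)
    (fun q hq => ciSup_abs_sub_le_trivial (Finset.mem_Icc.1 hq).1 hx1)
    (fun q _ => Real.iSup_nonneg fun a => norm_nonneg _)
    (fun q hq p hp hpq => h2 _ x hx1 q (Finset.mem_Icc.1 hq).1 p hp hpq)
    (fun m hm hmw => nonCoprimePart_le_three_mul_log_sq hm hx2 (hmw.trans (by linarith)))
    hpurx (fun Bad hB hBI => hbad x hx₁ I hI Bad hB hBI)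
  rw [Real.norm_of_nonneg (Finset.sum_nonneg fun q _ => Real.iSup_nonneg fun a => abs_nonneg _),
    Real.norm_of_nonneg (div_nonneg hx0 (Real.rpow_nonneg hL0 _))]
  refine main.trans ?_
  have hS := hC₀x
  rw [Real.norm_of_nonneg (Finset.sum_nonneg fun q _ => Real.iSup_nonneg fun a => norm_nonneg _),
    Real.norm_of_nonneg (div_nonneg hx0 (Real.rpow_nonneg hL0 _))] at hS
  have hQ : (⌊x ^ θ⌋₊ : ℝ) ≤ x ^ θ := Nat.floor_le (Real.rpow_nonneg hx0 _)
  have hev1' : x ^ θ * Real.log x ^ 2 ≤ x / Real.log x ^ A := by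
    have h := hev1; rwa [show (1 : ℝ) - (1 - θ) = θ by ring] at h
  exact numeric_bound hx1 hL1 hS (totientInvSum_le_four_mul_log_sq (hQ.trans hxθ) hL1) hQ
    hev1' hev2

end Summit.Parity.GeneralizedHardyLittlewood.Theorems.EH.DescentGraded
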